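import Summits.QuantumFields.YangMills.Theorems.BalabanUVNodesN15KingModelTheorem21Rate
import Literature.MathematicalPhysics.QuantumFieldTheory.King1986.CovarianceSplittingUnits

/-!
# BalabanUVNodes ∕ N15 — THE KING-MODEL RUNG (PART Ϝ-e): KING's RESCALING (2.20) FOR THE GENERATING FUNCTIONAL —
# `ln Z_η(Ω_M; m², h) = N₀^{−(d+2)}·ln Z_{N₀η}(Ω_{N₀M}; m²∕N₀², h∘flatten)` EXACTLY — AND THEOREM 2.1 BY NAME FOR SOURCES CONSTANT ON BLOCKS OF SIDE `L^{−k₀}`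
# (Track A, DAG node N15 = NE2; FAN-OUT v1.1 §N15 s3 «KING-MODEL RUNG … NE2's analogue DECIDED in the model»)

HONEST FRAMING.  Count-neutral (cell `pub-ymgap`, seat `pub-ymgap-dag-n15-e` g33; `--supports stmt-QuantumFields-27366 --as helper` = K3⁸
`SpineGivenEndpointR13SepCoPHV`).  TEMPLATE LITERATURE: C. King, *The U(1) Higgs model. I. The continuum limit*, Commun. Math. Phys. **102** (1986) 649–677
[King1986] — KING's OWN `A = 0`, `g = 0` MODEL (free massive lattice scalar field).  p.654 (2.20): *"If we rescale εZ^d to ηZ^d, the following relations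
hold between the operators on those lattices: G^ε_k(Ω, x, y) = (ε∕η)^{2−d}G^η_k((η∕ε)Ω, ηx∕ε, ηy∕ε) …"* — here for the free generating functional of part Ϝ-a,
with the tree's flat re-indexing `flatten : Tor (fine N₁ (fine N₀ M)) ≃ Tor (fine (N₁N₀) M)` and `lapF_flatten`∕`lapF_scale` of `King1986/CovarianceSplittingUnits`
(this lineage, g5).  NOT the U(1) Higgs model; NOT Bałaban's objects; NOT a node discharge (N15 is booked through n15-a's knit, untouched here); nothing
continuum-Yang–Mills ∕ ℝ⁴ ∕ OS ∕ mass-gap ∕ Clay.  0 `sorry`; standard axioms; TWO definitions (`levelSrc`, `kingFreeZlev` — the objects).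

THE MATHEMATICS.  Write the fine level as `N = N₁N₀`.  The free precision on the flat torus `Tor (fine (N₁N₀) M)` is `(N₁N₀)^{−d}·lapF((N₁N₀)², m²)`; along
`flatten` the operator `lapF` is carried to itself on the nested torus (`lapF_flatten`), and `lapF((N₁N₀)², m²) = N₀²·lapF(N₁², m²∕N₀²)` (`lapF_scale`): the SAME
Gaussian, read over the `N₀`-times larger unit torus `Ω′ = Tor (fine N₀ M)` at fine level `N₁` with mass `m²∕N₀²`, has precision `N₀^{2−d}` times the standard one.
Hence for EVERY source `h` on the flat torus: `ln Z_η(Ω_M; m², h) = ½(N₁N₀)^{−d}⟨h, B⁻¹h⟩ = N₀^{−(d+2)}·½N₁^{−d}⟨h∘flatten, B₁⁻¹(h∘flatten)⟩ = N₀^{−(d+2)}·ln Z_{η₁}(Ω′;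
m²∕N₀², h∘flatten)` — King's (2.20) for the generating functional (the source's canonical factor `N₀^{−(d+2)∕2}` squared; `ln Z(c·h) = c²ln Z(h)`).  A source CONSTANT ON
THE BLOCKS OF SIDE `N₁` fine sites (side `L^{−k₀}` in `T`'s coordinates when `N₀ = L^{k₀}`), `h = (J∘blk_{N₁})∘flatten⁻¹` with `J : Ω′ → ℝ`, is a UNIT-block source
over `Ω′`: so parts Ϝ-a∕Ϝ-b∕Ϝ-c apply verbatim with `(M, m², J) ↦ (fine N₀ M, m²∕N₀², J)` and the prefactor `N₀^{−(d+2)}`: exact plane-wave form over `Ω̂′`, `0 ≤ ln Z ≤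
N₀^{−(d+2)}·‖J‖²∕(2m²∕N₀²) = N₀^{−d}‖J‖²∕(2m²) ≤ H²|Ω|∕(2m²)` (`|Ω′| = N₀^d|Ω|` — the SAME constant as for unit-block sources, as it must be: it is `‖h‖²_η∕(2m²)`), the
limit `K → ∞` at fixed `k₀` by Ϡ-c's Tannery over `Ω′`, and the rate `ε_K²·L^{2k₀}`-shaped constant.  On the tori (2.21): for `N₀ = L^{k₀}`, `N₁ = L^{K−k₀}` (`K ≥ k₀`)
the functional IS `Z^{ε_K}(T_{ε_K}, h)` at a source constant on the `ε_{k₀}`-blocks, and `Thm21Printed` holds for it with `C = H²∕(2m²)`.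

WHAT THIS FILE PROVES (kernel).  §0 letters: `quadInv_submatrix_equiv` (`⟨v∘e, (A∘(e×e))⁻¹(v∘e)⟩ = ⟨v, A⁻¹v⟩`), `inv_smul_of_ne_zero`, `log_kingFineZ_eq` (`ln Z = ½η^d⟨h,B⁻¹h⟩`),
`log_kingFineZ_smul` (`ln Z(c·h) = c²ln Z(h)`).  §1 `lapF_flatten_eq_submatrix`, `lapF_prod_eq_smul` (`lapF((N₁N₀)², m²) = N₀²·lapF(N₁², m²∕N₀²)` on the nested torus),
★★★ **`log_kingFineZ_flatten`** ((2.20) for `Z`: `ln Z_η(Ω_M; m², h) = N₀^{−(d+2)}·ln Z_{η₁}(Ω′; m²∕N₀², h∘flatten)`, every source).  §2 `levelSrc` (`(J∘blk_{N₁})∘flatten⁻¹`),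
`levelSrc_comp_flatten`, ★★ **`log_kingFineZ_levelSrc_eq_fourier`** (`= N₀^{−(d+2)}·½|Ω′|⁻¹Σ_{q∈Ω̂′} S_{N₁}(q)|J̃(q)|²`), ★ `log_kingFineZ_levelSrc_nonneg`, ★★ `log_kingFineZ_levelSrc_le_vol`
(`≤ H²∕(2m²)·|Ω|`).  §3 (tori (2.21)) `kingFreeZlev` (`Z^{ε_K}(T_{ε_K}, ·)` at `ε_{k₀}`-block sources, `K ≥ k₀`), `kingFreeZlev_eq_of_le`, ★★ **`tendsto_kingFreeZlev`**,
`abs_log_kingFreeZlevLim_le`, ★★★ **`thm21Printed_kingFreeZlev`** (Theorem 2.1 BY NAME for every `k₀`).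

HONEST SCOPE.  Free field; sources constant on the blocks of ONE fixed `L`-adic scale `ε_{k₀}` (all such scales together are dense in `L²(T)`, but the passage to a
general `L²` source — uniformity in `k₀` — is NOT addressed: the (2.23) constant is `k₀`-free, the rate constant is not); odd `L ≥ 3` de facto, `m² > 0`.  N15 untouched;
counts unmoved.  Locators: [King1986] (2.4)–(2.9) p.652, (2.13)–(2.15) p.653, (2.20)–(2.23) p.654, (4.5) p.670, (4.35) p.674.
-/

noncomputable section

open scoped BigOperators
open Finset Matrix Filter Topology MeasureTheory

namespace Summit.QuantumFields.YangMills.BalabanUVNodes.N15KingModelRung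

open Literature.MathematicalPhysics.QuantumFieldTheory.Balaban1983to89.B5Prop11Plancherel (Tor fine chi sOf)
open Literature.MathematicalPhysics.QuantumFieldTheory.Balaban1983to89.QGQInverse (Coercive isUnit_of_coercive)
open Literature.MathematicalPhysics.QuantumFieldTheory.King1986 (aK aK_pos)
open Literature.MathematicalPhysics.QuantumFieldTheory.King1986.Torus
open Literature.MathematicalPhysics.QuantumFieldTheory.King1986.ContinuumLimit (eps eps_pos Torus221 Thm21Printed)
open Summit.QuantumFields.YangMills.BalabanUVNodes.N15KingModelRung.FreeField (gaussNorm)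

variable {d : ℕ}

/-! ## §0 Letters -/

section Letters

variable {m n : Type*} [Fintype m] [Fintype n] [DecidableEq m] [DecidableEq n]

/-- Quadratic forms of inverses are invariant under re-indexing by an equivalence: `⟨v∘e, (A.submatrix e e)⁻¹(v∘e)⟩ = ⟨v, A⁻¹v⟩`. [folklore] -/
theorem quadInv_submatrix_equiv (A : Matrix m m ℝ) (e : n ≃ m) (v : m → ℝ) :
    (v ∘ e) ⬝ᵥ ((A.submatrix e e)⁻¹ *ᵥ (v ∘ e)) = v ⬝ᵥ (A⁻¹ *ᵥ v) := by
  rw [Matrix.inv_submatrix_equiv, Matrix.submatrix_mulVec_equiv]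
  have h : (v ∘ e) ∘ e.symm = v := by
    funext x; simp
  rw [h, comp_equiv_dotProduct_comp_equiv]

/-- `(s·B)⁻¹ = s⁻¹·B⁻¹` for `s ≠ 0` and `B` with unit determinant. [folklore] -/
theorem inv_smul_of_ne_zero {B : Matrix m m ℝ} {s : ℝ} (hs : s ≠ 0) (hB : IsUnit B.det) : (s • B)⁻¹ = s⁻¹ • B⁻¹ := by
  refine Matrix.inv_eq_right_inv ?_
  rw [Matrix.smul_mul, Matrix.mul_smul, smul_smul, mul_inv_cancel₀ hs, one_smul, Matrix.mul_nonsing_inv _ hB]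

end Letters

section LogZ

variable (N : ℕ) [NeZero N] (M : Fin d → ℕ) [hM : ∀ μ, NeZero (M μ)]

/-- `ln Z_η(Ω, h) = ½η^d⟨h, B⁻¹h⟩` (`P_η⁻¹ = N^dB⁻¹`). [cite: King1986, (2.6) p.652, (2.13) p.653] -/
theorem log_kingFineZ_eq {m2 : ℝ} (hm : 0 < m2) (h : Tor (fine N M) → ℝ) :
    Real.log (kingFineZ N M m2 h) = (1 / 2 : ℝ) * (((N : ℝ) ^ d)⁻¹ * (h ⬝ᵥ ((lapF (fine N M) ((N : ℝ) ^ 2) m2)⁻¹ *ᵥ h))) := by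
  have hN : (N : ℝ) ^ d ≠ 0 := pow_ne_zero _ (by exact_mod_cast NeZero.ne N)
  rw [kingFineZ_eq_exp N M hm, Real.log_exp, fineFreePrec_inv N M hm, Matrix.smul_mulVec, Matrix.mulVec_smul, smul_dotProduct, dotProduct_smul,
    dotProduct_smul, smul_eq_mul, smul_eq_mul, smul_eq_mul]
  field_simp

/-- Homogeneity: `ln Z_η(Ω, c·h) = c²·ln Z_η(Ω, h)`. [cite: King1986, (2.6) p.652] -/
theorem log_kingFineZ_smul {m2 : ℝ} (hm : 0 < m2) (c : ℝ) (h : Tor (fine N M) → ℝ) :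
    Real.log (kingFineZ N M m2 (c • h)) = c ^ 2 * Real.log (kingFineZ N M m2 h) := by
  rw [log_kingFineZ_eq N M hm, log_kingFineZ_eq N M hm, Matrix.mulVec_smul, smul_dotProduct, dotProduct_smul, smul_eq_mul, smul_eq_mul]
  ring

end LogZ

/-! ## §1 King's rescaling (2.20) for the generating functional -/

section Rescaling

variable (N₁ N₀ : ℕ) [NeZero N₁] [NeZero N₀] (M : Fin d → ℕ) [hM : ∀ μ, NeZero (M μ)]

omit [NeZero N₁] [NeZero N₀] hM in
/-- `lapF` on the flat torus is the re-indexed `lapF` of the nested torus (tree `lapF_flatten`). [cite: King1986, (2.20) p.654] -/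
theorem lapF_flatten_eq_submatrix (c m2 : ℝ) :
    lapF (fine N₁ (fine N₀ M)) c m2 = (lapF (fine (N₁ * N₀) M) c m2).submatrix (flatten N₁ N₀ M) (flatten N₁ N₀ M) := by
  ext x y
  rw [Matrix.submatrix_apply, lapF_flatten]

/-- `lapF((N₁N₀)², m²) = N₀²·lapF(N₁², m²∕N₀²)` on the nested torus (tree `lapF_scale`). [cite: King1986, (2.20) p.654] -/
theorem lapF_prod_eq_smul (m2 : ℝ) :
    lapF (fine N₁ (fine N₀ M)) ((((N₁ * N₀ : ℕ) : ℝ)) ^ 2) m2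
      = ((N₀ : ℝ) ^ 2) • lapF (fine N₁ (fine N₀ M)) ((N₁ : ℝ) ^ 2) (m2 / (N₀ : ℝ) ^ 2) := by
  have hN₀ : (N₀ : ℝ) ^ 2 ≠ 0 := pow_ne_zero _ (by exact_mod_cast NeZero.ne N₀)
  rw [← lapF_scale]
  congr 1
  · push_cast; ring
  · exact (mul_div_cancel₀ m2 hN₀).symm

/-- ★★★ **KING's RESCALING (2.20) FOR THE GENERATING FUNCTIONAL**: for EVERY source `h` on the flat fine torus `Tor (fine (N₁N₀) M)` and `m² > 0`,
`ln Z_η(Ω_M; m², h) = N₀^{−(d+2)}·ln Z_{η₁}(Ω_{fine N₀ M}; m²∕N₀², h∘flatten)` (`η = (N₁N₀)⁻¹`, `η₁ = N₁⁻¹`): rescaling the lattice by `N₀` replaces the unit torus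
by the `N₀`-times larger one, the mass by `m∕N₀`, and a source picks up the canonical factor `N₀^{−(d+2)∕2}`. [cite: King1986, (2.20) p.654, (2.7)–(2.9) p.652] -/
theorem log_kingFineZ_flatten {m2 : ℝ} (hm : 0 < m2) (h : Tor (fine (N₁ * N₀) M) → ℝ) :
    Real.log (kingFineZ (N₁ * N₀) M m2 h)
      = (((N₀ : ℝ) ^ (d + 2))⁻¹) * Real.log (kingFineZ N₁ (fine N₀ M) (m2 / (N₀ : ℝ) ^ 2) (h ∘ flatten N₁ N₀ M)) := by
  have hN₀r : (0 : ℝ) < N₀ := by exact_mod_cast Nat.pos_of_ne_zero (NeZero.ne N₀)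
  have hN₁r : (0 : ℝ) < N₁ := by exact_mod_cast Nat.pos_of_ne_zero (NeZero.ne N₁)
  have hN₀2 : (N₀ : ℝ) ^ 2 ≠ 0 := pow_ne_zero _ hN₀r.ne'
  have hm' : 0 < m2 / (N₀ : ℝ) ^ 2 := by positivity
  rw [log_kingFineZ_eq (N₁ * N₀) M hm, log_kingFineZ_eq N₁ (fine N₀ M) hm']
  -- transport the flat quadratic form to the nested torus
  have hflat : h ⬝ᵥ ((lapF (fine (N₁ * N₀) M) ((((N₁ * N₀ : ℕ) : ℝ)) ^ 2) m2)⁻¹ *ᵥ h)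
      = (h ∘ flatten N₁ N₀ M) ⬝ᵥ ((lapF (fine N₁ (fine N₀ M)) ((((N₁ * N₀ : ℕ) : ℝ)) ^ 2) m2)⁻¹ *ᵥ (h ∘ flatten N₁ N₀ M)) := by
    rw [lapF_flatten_eq_submatrix, quadInv_submatrix_equiv]
  have hunit : IsUnit (lapF (fine N₁ (fine N₀ M)) ((N₁ : ℝ) ^ 2) (m2 / (N₀ : ℝ) ^ 2)).det := isUnit_det_lapF N₁ (fine N₀ M) hm'
  rw [hflat, lapF_prod_eq_smul, inv_smul_of_ne_zero hN₀2 hunit, Matrix.smul_mulVec, dotProduct_smul, smul_eq_mul]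
  push_cast
  field_simp
  ring

end Rescaling

/-! ## §2 Sources constant on the blocks of a fixed finer scale -/

section Level

variable (N₁ N₀ : ℕ) [NeZero N₁] [NeZero N₀] (M : Fin d → ℕ) [hM : ∀ μ, NeZero (M μ)]

/-- A source on the flat fine torus `Tor (fine (N₁N₀) M)` that is CONSTANT ON THE BLOCKS OF `N₁^d` SITES (the blocks of the intermediate lattice `Ω′ = Tor (fine N₀ M)`):
`(J∘blk_{N₁})∘flatten⁻¹`, `J : Ω′ → ℝ`. [cite: King1986, (2.4) p.652, (2.20) p.654] -/
def levelSrc (J : Tor (fine N₀ M) → ℝ) : Tor (fine (N₁ * N₀) M) → ℝ := blockSrc N₁ (fine N₀ M) J ∘ (flatten N₁ N₀ M).symm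

/-- Read on the nested torus the level source is the unit-block source over `Ω′`. [folklore] -/
theorem levelSrc_comp_flatten (J : Tor (fine N₀ M) → ℝ) : levelSrc N₁ N₀ M J ∘ flatten N₁ N₀ M = blockSrc N₁ (fine N₀ M) J := by
  funext x
  simp [levelSrc]

/-- A bounded `J` gives a bounded level source. [folklore] -/
theorem abs_levelSrc_le {J : Tor (fine N₀ M) → ℝ} {H : ℝ} (hJ : ∀ b, |J b| ≤ H) (x : Tor (fine (N₁ * N₀) M)) : |levelSrc N₁ N₀ M J x| ≤ H := by
  simp only [levelSrc, Function.comp_apply, blockSrc_apply]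
  exact hJ _

/-- ★★ **THE EXACT PLANE-WAVE FORM AT A LEVEL SOURCE**: `ln Z_η(Ω_M; m², (J∘blk_{N₁})∘flatten⁻¹) = N₀^{−(d+2)}·½|Ω′|⁻¹Σ_{q ∈ Ω̂′} S_{N₁}(q; m²∕N₀²)|J̃(q)|²`.
[cite: King1986, (2.20) p.654, (4.5) p.670, (4.35) p.674] -/
theorem log_kingFineZ_levelSrc_eq_fourier {m2 : ℝ} (hm : 0 < m2) (J : Tor (fine N₀ M) → ℝ) :
    Real.log (kingFineZ (N₁ * N₀) M m2 (levelSrc N₁ N₀ M J))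
      = (((N₀ : ℝ) ^ (d + 2))⁻¹) * ((1 / 2 : ℝ) * ((Fintype.card (Tor (fine N₀ M)) : ℝ)⁻¹
          * ∑ q : Tor (fine N₀ M), Sfib N₁ (fine N₀ M) ((N₁ : ℝ) ^ 2) (m2 / (N₀ : ℝ) ^ 2) q * ‖ft (fine N₀ M) J q‖ ^ 2)) := by
  have hN₀r : (0 : ℝ) < N₀ := by exact_mod_cast Nat.pos_of_ne_zero (NeZero.ne N₀)
  have hm' : 0 < m2 / (N₀ : ℝ) ^ 2 := by positivity
  rw [log_kingFineZ_flatten N₁ N₀ M hm, levelSrc_comp_flatten, log_kingFineZ_blockSrc_eq_fourier N₁ (fine N₀ M) hm']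

/-- ★ `0 ≤ ln Z_η(Ω_M; m², level source)`. [cite: King1986, Thm 2.1 (2.23) p.654] -/
theorem log_kingFineZ_levelSrc_nonneg {m2 : ℝ} (hm : 0 < m2) (J : Tor (fine N₀ M) → ℝ) : 0 ≤ Real.log (kingFineZ (N₁ * N₀) M m2 (levelSrc N₁ N₀ M J)) :=
  log_kingFineZ_nonneg (N₁ * N₀) M hm _

/-- ★★ **THE EXTENSIVE BOUND WITH THE SAME CONSTANT**: `ln Z_η(Ω_M; m², level source) ≤ H²∕(2m²)·|Ω_M|` for `|J| ≤ H` — `k₀`-free (it is `‖h‖²_η∕(2m²)`).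
[cite: King1986, Thm 2.1 (2.23) p.654] -/
theorem log_kingFineZ_levelSrc_le_vol {m2 : ℝ} (hm : 0 < m2) {J : Tor (fine N₀ M) → ℝ} {H : ℝ} (hJ : ∀ b, |J b| ≤ H) :
    Real.log (kingFineZ (N₁ * N₀) M m2 (levelSrc N₁ N₀ M J)) ≤ H ^ 2 / (2 * m2) * Fintype.card (Tor M) := by
  have hN : (0 : ℝ) < ((N₁ * N₀ : ℕ) : ℝ) ^ d := pow_pos (by exact_mod_cast Nat.pos_of_ne_zero (NeZero.ne (N₁ * N₀))) d
  have h1 := log_kingFineZ_le (N₁ * N₀) M hm (levelSrc N₁ N₀ M J)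
  -- `η^d Σ_x h(x)² ≤ η^d · |Ω_η| · H² = |Ω| H²`
  have h2 : levelSrc N₁ N₀ M J ⬝ᵥ levelSrc N₁ N₀ M J ≤ H ^ 2 * Fintype.card (Tor (fine (N₁ * N₀) M)) := by
    calc levelSrc N₁ N₀ M J ⬝ᵥ levelSrc N₁ N₀ M J = ∑ x, levelSrc N₁ N₀ M J x ^ 2 := by simp [dotProduct, sq]
      _ ≤ ∑ _x : Tor (fine (N₁ * N₀) M), H ^ 2 := Finset.sum_le_sum fun x _ => by
          rw [← sq_abs]; exact pow_le_pow_left₀ (abs_nonneg _) (abs_levelSrc_le N₁ N₀ M hJ x) 2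
      _ = H ^ 2 * Fintype.card (Tor (fine (N₁ * N₀) M)) := by rw [Finset.sum_const, Finset.card_univ, nsmul_eq_mul, mul_comm]
  have hcard := Literature.MathematicalPhysics.QuantumFieldTheory.Balaban1983to89.B5Block118.card_fine (N₁ * N₀) M
  calc Real.log (kingFineZ (N₁ * N₀) M m2 (levelSrc N₁ N₀ M J))
      ≤ (((N₁ * N₀ : ℕ) : ℝ) ^ d)⁻¹ * (levelSrc N₁ N₀ M J ⬝ᵥ levelSrc N₁ N₀ M J) / (2 * m2) := h1
    _ ≤ (((N₁ * N₀ : ℕ) : ℝ) ^ d)⁻¹ * (H ^ 2 * Fintype.card (Tor (fine (N₁ * N₀) M))) / (2 * m2) := by gcongr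
    _ = H ^ 2 / (2 * m2) * Fintype.card (Tor M) := by rw [hcard]; field_simp

end Level

/-! ## §3 Theorem 2.1 by name for sources constant on the `ε_{k₀}`-blocks -/

section Torus

variable (L : ℕ) [NeZero L] (m2 : ℝ) (k₀ : ℕ)

/-- **The free functionals at `ε_{k₀}`-block sources on the tori (2.21)**: for `K ≥ k₀`, `Z^{ε_K}(T_{ε_K}, h)` with `h` constant on the blocks of side `ε_{k₀} = L^{−k₀}`,
given by `J_T : Tor (fine (L^{k₀}) Ω_T) → ℝ` (the fine level split as `L^{K−k₀}·L^{k₀}`; for `K < k₀` the value at depth `k₀` is used). [cite: King1986, (2.21)–(2.22) p.654] -/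
def kingFreeZlev (J : ∀ T : Torus221 (d + 1), Tor (fine (L ^ k₀) (t221Sites T)) → ℝ) : Torus221 (d + 1) → ℕ → ℝ := fun T K =>
  haveI := t221Sites_neZero T
  kingFineZ (L ^ (K - k₀) * L ^ k₀) (t221Sites T) m2 (levelSrc (L ^ (K - k₀)) (L ^ k₀) (t221Sites T) (J T))

/-- The limit functional `exp(L^{−k₀(d+3)}·½|Ω′_T|⁻¹Σ_{q∈Ω̂′_T} S_∞(p′(q); m²L^{−2k₀})|J̃_T(q)|²)`, `Ω′_T = Tor (fine (L^{k₀}) Ω_T)`. [cite: King1986, Thm 2.1 (2.22) p.654] -/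
def kingFreeZlevLim (J : ∀ T : Torus221 (d + 1), Tor (fine (L ^ k₀) (t221Sites T)) → ℝ) (T : Torus221 (d + 1)) : ℝ :=
  haveI := t221Sites_neZero T
  Real.exp ((((L ^ k₀ : ℕ) : ℝ) ^ (d + 1 + 2))⁻¹ * ((1 / 2 : ℝ) * (((Fintype.card (Tor (fine (L ^ k₀) (t221Sites T)))) : ℝ)⁻¹ * ∑ q : Tor (fine (L ^ k₀) (t221Sites T)), aliasSeries0 (m2 / ((L ^ k₀ : ℕ) : ℝ) ^ 2) (sOf (fine (L ^ k₀) (t221Sites T)) q) * ‖ft (fine (L ^ k₀) (t221Sites T)) (J T) q‖ ^ 2)))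

omit [NeZero L] in
/-- For `K ≥ k₀` the fine level is `L^{K−k₀}·L^{k₀} = L^K`: the functional is `Z^{ε_K}`. [cite: King1986, (2.21) p.654] -/
theorem pow_sub_mul_pow {K : ℕ} (hK : k₀ ≤ K) : L ^ (K - k₀) * L ^ k₀ = L ^ K := by
  rw [← pow_add, Nat.sub_add_cancel hK]

/-- `ln Z^{ε_K}` at a level source, in plane waves over `Ω′_T` (every `K`). [cite: King1986, (2.20) p.654, (4.5) p.670] -/
theorem log_kingFreeZlev_eq (hm : 0 < m2) (J : ∀ T : Torus221 (d + 1), Tor (fine (L ^ k₀) (t221Sites T)) → ℝ) (T : Torus221 (d + 1)) (K : ℕ) :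
    haveI := t221Sites_neZero T
    Real.log (kingFreeZlev L m2 k₀ J T K)
      = (((L ^ k₀ : ℕ) : ℝ) ^ (d + 1 + 2))⁻¹ * ((1 / 2 : ℝ) * (((Fintype.card (Tor (fine (L ^ k₀) (t221Sites T)))) : ℝ)⁻¹
          * ∑ q : Tor (fine (L ^ k₀) (t221Sites T)), Sfib (L ^ (K - k₀)) (fine (L ^ k₀) (t221Sites T)) (((L ^ (K - k₀) : ℕ) : ℝ) ^ 2) (m2 / ((L ^ k₀ : ℕ) : ℝ) ^ 2) q * ‖ft (fine (L ^ k₀) (t221Sites T)) (J T) q‖ ^ 2)) := by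
  haveI := t221Sites_neZero T
  unfold kingFreeZlev
  rw [log_kingFineZ_levelSrc_eq_fourier (L ^ (K - k₀)) (L ^ k₀) (t221Sites T) hm]

/-- ★★ **(2.22) AT LEVEL SOURCES**: `Z^{ε_K}(T_{ε_K}, h) → Z(T, h)` for `h` constant on the `ε_{k₀}`-blocks (odd `L ≥ 2`, `m² > 0`). [cite: King1986, Thm 2.1 (2.22) p.654] -/
theorem tendsto_kingFreeZlev (hLodd : Odd L) (hL : 2 ≤ L) (hm : 0 < m2) (J : ∀ T : Torus221 (d + 1), Tor (fine (L ^ k₀) (t221Sites T)) → ℝ)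
    (T : Torus221 (d + 1)) :
    Tendsto (fun K : ℕ => kingFreeZlev L m2 k₀ J T K) atTop (𝓝 (kingFreeZlevLim L m2 k₀ J T)) := by
  haveI := t221Sites_neZero T
  have hpos : ∀ K, 0 < kingFreeZlev L m2 k₀ J T K := fun K => by
    unfold kingFreeZlev; exact kingFineZ_pos _ _ hm _
  have hm' : 0 < m2 / ((L ^ k₀ : ℕ) : ℝ) ^ 2 := by
    have : (0 : ℝ) < ((L ^ k₀ : ℕ) : ℝ) := by exact_mod_cast Nat.pos_of_ne_zero (NeZero.ne (L ^ k₀))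
    positivity
  -- the logarithms converge (Ϡ-c's Tannery over `Ω′_T`, along `K − k₀ → ∞`)
  have hlog : Tendsto (fun K : ℕ => Real.log (kingFreeZlev L m2 k₀ J T K)) atTop
      (𝓝 ((((L ^ k₀ : ℕ) : ℝ) ^ (d + 1 + 2))⁻¹ * ((1 / 2 : ℝ) * (((Fintype.card (Tor (fine (L ^ k₀) (t221Sites T)))) : ℝ)⁻¹ * ∑ q : Tor (fine (L ^ k₀) (t221Sites T)), aliasSeries0 (m2 / ((L ^ k₀ : ℕ) : ℝ) ^ 2) (sOf (fine (L ^ k₀) (t221Sites T)) q) * ‖ft (fine (L ^ k₀) (t221Sites T)) (J T) q‖ ^ 2)))) := by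
    have hfun : (fun K : ℕ => Real.log (kingFreeZlev L m2 k₀ J T K)) = fun K : ℕ =>
        (((L ^ k₀ : ℕ) : ℝ) ^ (d + 1 + 2))⁻¹ * ((1 / 2 : ℝ) * (((Fintype.card (Tor (fine (L ^ k₀) (t221Sites T)))) : ℝ)⁻¹
          * ∑ q : Tor (fine (L ^ k₀) (t221Sites T)), Sfib (L ^ (K - k₀)) (fine (L ^ k₀) (t221Sites T)) (((L ^ (K - k₀) : ℕ) : ℝ) ^ 2) (m2 / ((L ^ k₀ : ℕ) : ℝ) ^ 2) q * ‖ft (fine (L ^ k₀) (t221Sites T)) (J T) q‖ ^ 2)) :=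
      funext fun K => log_kingFreeZlev_eq L m2 k₀ hm J T K
    rw [hfun]
    refine Tendsto.const_mul _ (Tendsto.const_mul _ (Tendsto.const_mul _ (tendsto_finsetSum _ fun q _ => ?_)))
    have h := (tendsto_Sfib_pow L (fine (L ^ k₀) (t221Sites T)) hLodd hL hm' q).comp (tendsto_sub_atTop_nat k₀)
    exact h.mul_const _
  have hexp := (Real.continuous_exp.tendsto _).comp hlog
  unfold kingFreeZlevLim
  refine hexp.congr fun K => ?_
  simp only [Function.comp_apply, Real.exp_log (hpos K)]

/-- `Z(T, h) > 0`. [folklore] -/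
theorem kingFreeZlevLim_pos (J : ∀ T : Torus221 (d + 1), Tor (fine (L ^ k₀) (t221Sites T)) → ℝ) (T : Torus221 (d + 1)) :
    0 < kingFreeZlevLim L m2 k₀ J T := Real.exp_pos _

/-- ★★ **(2.23) AT LEVEL SOURCES, SAME CONSTANT**: `|ln Z(T, h)| ≤ (H²∕(2m²))·|T|` for `|J_T| ≤ H` — the constant does not see `k₀`. [cite: King1986, Thm 2.1 (2.23) p.654] -/
theorem abs_log_kingFreeZlevLim_le (hLodd : Odd L) (hL : 2 ≤ L) (hm : 0 < m2) {J : ∀ T : Torus221 (d + 1), Tor (fine (L ^ k₀) (t221Sites T)) → ℝ}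
    {H : ℝ} (hJ : ∀ T b, |J T b| ≤ H) (T : Torus221 (d + 1)) :
    |Real.log (kingFreeZlevLim L m2 k₀ J T)| ≤ H ^ 2 / (2 * m2) * T.vol := by
  haveI := t221Sites_neZero T
  -- pass the finite-`K` bounds `0 ≤ ln Z^{ε_K} ≤ H²|T|∕(2m²)` to the limit
  have hlim : Tendsto (fun K : ℕ => Real.log (kingFreeZlev L m2 k₀ J T K)) atTop (𝓝 (Real.log (kingFreeZlevLim L m2 k₀ J T))) :=
    (Real.continuousAt_log (kingFreeZlevLim_pos L m2 k₀ J T).ne').tendsto.comp (tendsto_kingFreeZlev L m2 k₀ hLodd hL hm J T)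
  have hlo : 0 ≤ Real.log (kingFreeZlevLim L m2 k₀ J T) :=
    ge_of_tendsto hlim (Filter.Eventually.of_forall fun K => by
      unfold kingFreeZlev; exact log_kingFineZ_levelSrc_nonneg _ _ _ hm _)
  have hhi : Real.log (kingFreeZlevLim L m2 k₀ J T) ≤ H ^ 2 / (2 * m2) * T.vol :=
    le_of_tendsto hlim (Filter.Eventually.of_forall fun K => by
      rw [← card_tor_t221Sites T]
      unfold kingFreeZlev
      exact log_kingFineZ_levelSrc_le_vol _ _ _ hm (hJ T))
  rw [abs_of_nonneg hlo]
  exact hhi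

/-- ★★★ **KING's THEOREM 2.1 BY NAME FOR SOURCES CONSTANT ON THE `ε_{k₀}`-BLOCKS**: for odd `L ≥ 2`, `m² > 0`, every `k₀` and every family `|J_T| ≤ H` of sources on
the `ε_{k₀}`-lattices of the tori (2.21), the free functionals `(T, K) ↦ Z^{ε_K}(T_{ε_K}, J_T∘blk_{ε_{k₀}})` satisfy `Thm21Printed` with `C = H²∕(2m²)`.
[cite: King1986, Thm 2.1 (2.22)–(2.23) p.654, (2.20) p.654] -/
theorem thm21Printed_kingFreeZlev (hLodd : Odd L) (hL : 2 ≤ L) (hm : 0 < m2) {J : ∀ T : Torus221 (d + 1), Tor (fine (L ^ k₀) (t221Sites T)) → ℝ}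
    {H : ℝ} (hJ : ∀ T b, |J T b| ≤ H) : Thm21Printed (kingFreeZlev L m2 k₀ J) :=
  ⟨H ^ 2 / (2 * m2), fun T =>
    ⟨kingFreeZlevLim L m2 k₀ J T, kingFreeZlevLim_pos L m2 k₀ J T, tendsto_kingFreeZlev L m2 k₀ hLodd hL hm J T,
      abs_log_kingFreeZlevLim_le L m2 k₀ hLodd hL hm hJ T⟩⟩

/-- At `k₀ = 0` the level functionals are part Ϝ-b's unit-block functionals (`levelSrc` over `fine 1 Ω_T` read through `flatten`): the logarithms agree.
[cite: King1986, (2.20) p.654] -/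
theorem log_kingFreeZlev_zero_eq (hm : 0 < m2) (J : ∀ T : Torus221 (d + 1), Tor (fine (L ^ 0) (t221Sites T)) → ℝ) (T : Torus221 (d + 1)) (K : ℕ) :
    haveI := t221Sites_neZero T
    Real.log (kingFreeZlev L m2 0 J T K)
      = Real.log (kingFineZ (L ^ K) (fine (L ^ 0) (t221Sites T)) m2 (blockSrc (L ^ K) (fine (L ^ 0) (t221Sites T)) (J T))) := by
  haveI := t221Sites_neZero T
  unfold kingFreeZlev
  rw [log_kingFineZ_flatten (L ^ (K - 0)) (L ^ 0) (t221Sites T) hm, levelSrc_comp_flatten]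
  simp

end Torus

end Summit.QuantumFields.YangMills.BalabanUVNodes.N15KingModelRung

end
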